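import Summits.BirchSwinnertonDyer.BirchSwinnertonDyer.Theorems.ResidualThetaTransportAtTwoKatoZetaDefs
import Summits.BirchSwinnertonDyer.BirchSwinnertonDyer.Theorems.ResidualThetaTransportAtTwoResidualThetaMainConjectureAtTwoEvalK
import Literature.NumberTheory.EllipticCurves.PAdicPowerSeriesZeros
import HarnessLib

/-!
# Station (R) step D′ kit (forward half), §0: cyclotomic lemmas at `p = 2` — `2`-power order of characters mod `2^{K+1}`, `((−1)^{N/2+1} ω⁻_N)(ζ − 1) ≠ 0`
# (`N` even) / `ω⁺` (`N` odd) at `ζ` of exact order `2^N`, `θ_N` at `p = 2` read as a Galois sum, and (H-CHAR) every primitive `2^N`-th root of unity in `ℂ₂`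
# is `ψ(5)` for an EVEN PRIMITIVE `ψ` mod `2^{N+2}`

Route `ResidualThetaTransportAtTwo` (RTT), crux RSL_g `ResidualSignedLambdaLowerCMAtTwo` (stmt-BirchSwinnertonDyer-22608), line «onepair» v3g,
registered KERNEL stub `stub_kzgValueRelation` = station (R) — its load-bearing STEP D′ `π.cvec z ≠ 0` for a Kato valued class (STUB-PLAN rev 29,
S155/T90; port lane of the (R) writer `prover-bsd-wall-tp2-p2x-w3` g18, who consumes this file by name). Width seat `prover-bsd-wall-tp2-p2x-w2` g22
(`--supports 22608 --as helper`, closes nothing). THEOREMS ONLY (no `def`, no instance, no notation, no named fact, no `sorry`). BSD is NOT proved by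
any of this; 22608 / 26074 / 24105 stay OPEN / HOLD; nothing here asserts child A / child B / (R).

PORT of the kernel-checked sketch `Cruxes/ResidualThetaCountLowerPureAtTwo/Sketch_sidea_k4_g26.lean` v2 (stub-ideation k4 g26 «assume the opposite:
the degenerate instances of station (R)»; STUB-PLAN rev 29 row 105), statements and proofs VERBATIM up to the namespace (the zero-tuple audit §A/§A′/§B
of the sketch is not ported); credit: stub-ideation k4 g26 (every statement and proof). The displayed helper hypotheses (H-RIG) / (H-FIN) stay
hypotheses exactly as in the sketch ((H-RIG) = `StationR.Road.eq_zero_of_forall_primitive_tsum_eq_zero`, p722826, discharged by the consumer).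

References: [Washington1997] §7.2; [MazurTateTeitelbaum1986Invent] §I.13; [Pollack2003] Lemma 4.7.
-/

set_option autoImplicit false
-- the Theorems namespace of this sub repeats the summit name by design (D-0017 nested layout)
set_option linter.dupNamespace false
set_option backward.isDefEq.respectTransparency false

noncomputable section

open scoped Classical NumberField

open Polynomial
open Literature.NumberTheory.EllipticCurves Literature.NumberTheory.EllipticCurves.GreenbergSelmer
open Literature.NumberTheory.EllipticCurves.ModularForms
open Literature.NumberTheory.GaloisRepresentations NumberField IsDedekindDomain Field
open GreenbergVatsal2000 Kobayashi2003 Rat.HeightOneSpectrum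
open Summit.BirchSwinnertonDyer.Rank1Residual.Additive Summit.BirchSwinnertonDyer.Rank1Residual.Additive.PadicCyclotomicTower
open Summit.BirchSwinnertonDyer.BirchSwinnertonDyer.Theorems.OnePair
open Summit.BirchSwinnertonDyer.BirchSwinnertonDyer.Theorems

namespace Summit.BirchSwinnertonDyer.BirchSwinnertonDyer.Theorems.ThetaTransport.StationRValVisible

/-! ## §0 Cyclotomic lemmas at `p = 2` (no pins) -/

/-- A Dirichlet character modulo `2^(K+1)` has `2`-power order (the unit group `(ℤ/2^{K+1})ˣ` has order `2^K`). [folklore] -/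
theorem exists_orderOf_eq_two_pow {R : Type*} [CommRing R] [IsDomain R] (K : ℕ)
    (χ : DirichletCharacter R (2 ^ (K + 1))) : ∃ j : ℕ, orderOf χ = 2 ^ j := by
  classical
  haveI : NeZero (2 ^ (K + 1)) := ⟨pow_ne_zero _ two_ne_zero⟩
  have h1 : χ ^ Fintype.card (ZMod (2 ^ (K + 1)))ˣ = 1 := by
    apply MulChar.ext
    intro a
    rw [MulChar.pow_apply_coe, ← map_pow, ← Units.val_pow_eq_pow_val, pow_card_eq_one, Units.val_one, map_one,
      MulChar.one_apply_coe]
  have hdvd := orderOf_dvd_of_pow_eq_one h1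
  rw [ZMod.card_units_eq_totient, Nat.totient_prime_pow_succ Nat.prime_two] at hdvd
  norm_num at hdvd
  obtain ⟨j, -, hj⟩ := (Nat.dvd_prime_pow Nat.prime_two).mp hdvd
  exact ⟨j, hj⟩

/-- **`((−1)^{N/2+1} ω⁻_N)(ζ − 1) ≠ 0` for `ζ ∈ ℂ₂` of exact order `2^N`, `N` even**: the roots of `ω⁻_N(T) = ∏_{odd j ≤ N} Φ_{2^j}(1+T)`
are the `ζ' − 1` with `ζ'` of exact order `2^j`, `j` odd. [cite: Pollack2003, §6.5 (display before Prop. 6.18)] -/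
theorem eval₂_signedOmegaMinus_ne_zero {N : ℕ} (hN : Even N) {ζ : ℂ_[2]} (hζ : IsPrimitiveRoot ζ (2 ^ N)) :
    (((-1 : ℤ[X]) ^ (N / 2 + 1) * cyclotomicOmegaMinus 2 N).map (Int.castRingHom (PadicAlgCl 2))).eval₂
        (algebraMap (PadicAlgCl 2) ℂ_[2]) (ζ - 1) ≠ 0 := by
  classical
  rw [eval₂_map, eval₂_mul, eval₂_pow, eval₂_neg, eval₂_one, cyclotomicOmegaMinus, eval₂_finsetProd]
  refine mul_ne_zero (pow_ne_zero _ (neg_ne_zero.mpr one_ne_zero)) ?_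
  rw [Finset.prod_ne_zero_iff]
  intro k hk h0
  rw [eval₂_comp, eval₂_add, eval₂_X, eval₂_one, sub_add_cancel, eval₂_eq_eval_map, map_cyclotomic] at h0
  haveI : NeZero ((2 ^ (2 * k - 1) : ℕ) : ℂ_[2]) := ⟨by exact_mod_cast pow_ne_zero _ two_ne_zero⟩
  have hprim : IsPrimitiveRoot ζ (2 ^ (2 * k - 1)) := (isRoot_cyclotomic_iff).mp h0
  have heq : 2 ^ (2 * k - 1) = 2 ^ N := hprim.unique hζ
  have hk' : 2 * k - 1 = N := Nat.pow_right_injective le_rfl heq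
  rw [Finset.mem_Icc] at hk
  obtain ⟨r, hr⟩ := hN
  omega

/-- **`((−1)^{N/2+1} ω⁺_N)(ζ − 1) ≠ 0` for `ζ ∈ ℂ₂` of exact order `2^N`, `N` odd**: the roots of `ω⁺_N(T) = ∏_{even j ≤ N} Φ_{2^j}(1+T)` are
the `ζ' − 1` with `ζ'` of exact order `2^j`, `j` even. [cite: Pollack2003, §6.5 (display before Prop. 6.18)] -/
theorem eval₂_signedOmegaPlus_ne_zero {N : ℕ} (hN : Odd N) {ζ : ℂ_[2]} (hζ : IsPrimitiveRoot ζ (2 ^ N)) :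
    (((-1 : ℤ[X]) ^ (N / 2 + 1) * cyclotomicOmegaPlus 2 N).map (Int.castRingHom (PadicAlgCl 2))).eval₂
        (algebraMap (PadicAlgCl 2) ℂ_[2]) (ζ - 1) ≠ 0 := by
  classical
  rw [eval₂_map, eval₂_mul, eval₂_pow, eval₂_neg, eval₂_one, cyclotomicOmegaPlus, eval₂_finsetProd]
  refine mul_ne_zero (pow_ne_zero _ (neg_ne_zero.mpr one_ne_zero)) ?_
  rw [Finset.prod_ne_zero_iff]
  intro k hk h0
  rw [eval₂_comp, eval₂_add, eval₂_X, eval₂_one, sub_add_cancel, eval₂_eq_eval_map, map_cyclotomic] at h0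
  haveI : NeZero ((2 ^ (2 * k) : ℕ) : ℂ_[2]) := ⟨by exact_mod_cast pow_ne_zero _ two_ne_zero⟩
  have hprim : IsPrimitiveRoot ζ (2 ^ (2 * k)) := (isRoot_cyclotomic_iff).mp h0
  have heq : 2 ^ (2 * k) = 2 ^ N := hprim.unique hζ
  have hk' : 2 * k = N := Nat.pow_right_injective le_rfl heq
  rw [Finset.mem_Icc] at hk
  obtain ⟨r, hr⟩ := hN
  omega

variable {M : ℕ} [NeZero M] (g : CuspForm (CongruenceSubgroup.Gamma0 M) 2) (ι : coeffField g →+* PadicAlgCl 2) (Ω : ℂ)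

omit [NeZero M] in
/-- **The tree's evaluation lemma `eval₂_map_mazurTateElementK_eq_sum` read at `p = 2`** (`e₀ = 2`, `γ₀ = 5`):
`θ_N(g;Ω)^ι(χ(5) − 1) = Σ_{a mod 2^{N+2}} χ(a) ι[a/2^{N+2}]⁺_{g,Ω}` for an even `ℂ₂`-valued `χ` mod `2^{N+2}`. [cite: Pollack2003, Prop. 6.9 (proof)] -/
theorem eval₂_map_mazurTateElementK_two {N : ℕ} (χ : DirichletCharacter ℂ_[2] (2 ^ (N + 2))) (heven : χ.Even) :
    ((mazurTateElementK g Ω 2 N).map ι).eval₂ (algebraMap (PadicAlgCl 2) ℂ_[2]) (χ (5 : ZMod (2 ^ (N + 2))) - 1) =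
      ∑ a : ZMod (2 ^ (N + 2)), χ a * algebraMap (PadicAlgCl 2) ℂ_[2] (ι (plusSymbolK g Ω ((a.val : ℚ) / (2 : ℚ) ^ (N + 2)))) := by
  have h := ResidualThetaLayer.eval₂_map_mazurTateElementK_eq_sum (p := 2) g ι Ω (n := N) χ heven
    (exists_orderOf_eq_two_pow (N + 1) χ)
  have h5 : ((cyclotomicGenerator 2 : ℕ) : ZMod (2 ^ (N + cyclotomicExponent 2))) = (5 : ZMod (2 ^ (N + 2))) := by
    show ((1 + 2 ^ 2 : ℕ) : ZMod (2 ^ (N + 2))) = 5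
    norm_num
  rw [h5] at h
  simpa [cyclotomicExponent] using h


/-! ## The pin bundle -/

variable {S : Set (PadicAlgCl 2)} {W : WeierstrassCurve ℚ} [W.IsElliptic] {κ : ZpExtension ℚ 2} {γ : absoluteGaloisGroup ℚ}
  {S₀ : Finset (HeightOneSpectrum (𝓞 ℚ))} {n : ℕ} {ρ : FramedGaloisRep ℚ ↥(padicCoeffIntegers S) 2}
  {Θ : ∀ v : HeightOneSpectrum (𝓞 ℚ), ((2 : ℕ) : 𝓞 ℚ) ∈ v.asIdeal → (Cofree ρ ↥(padicCoeffField S) ≃+ (Fin n → ↥(W.geomPrimaryTorsion 2)))}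
  {hΘ : ∀ v hv (δ : absoluteGaloisGroup (v.adicCompletion ℚ)) m i,
    Θ v hv (resGalOfEmb (closureEmb (K := ℚ) (v.adicCompletion ℚ)) δ • m) i = resGalOfEmb (closureEmb (K := ℚ) (v.adicCompletion ℚ)) δ • Θ v hv m i}
  {I : Kato2004.IwasawaH1DataCoeff (FramedGaloisRep.toGaloisRep ρ) 2 κ γ}
  {Sg : AddSubgroup (subgroupH1 κ.kerSubgroup (Cofree ρ ↥(padicCoeffField S)))} [Module ↥(padicCoeffIntegers S) ↥Sg]
  (π : OnePairPins S W κ γ S₀ n ρ Θ hΘ I Sg)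


/-- **(H-CHAR, PROVED) every primitive `2^N`-th root of unity `ζ ∈ ℂ₂` (`N ≥ 1`) is `ψ(5)` for an EVEN PRIMITIVE `ℚ̄₂`-valued
Dirichlet character `ψ` modulo `2^{N+2}`.** Take a primitive even `ψ₁` of `2`-power order (`exists_isPrimitive_even_orderOf_eq_prime_pow`);
`ψ₁(5)` has exact order `2^N` (`orderOf_apply_cyclotomicGenerator`, read in `ℂ₂`), so `ζ = ψ₁(5)^i` with `i` odd, and `ψ = ψ₁^i` is even,
takes the value `ζ` at `5`, and is primitive because `ψ₁` is a power of it (`conductor_pow_dvd` both ways).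
[cite: Washington1997, §7.2] [cite: MazurTateTeitelbaum1986Invent, §I.13] -/
theorem exists_even_primitive_apply_five_eq (N : ℕ) (ζ : ℂ_[2]) (hN : 1 ≤ N) (hζ : IsPrimitiveRoot ζ (2 ^ N)) :
    ∃ ψ : DirichletCharacter (PadicAlgCl 2) (2 ^ (N + 2)), ψ (-1) = 1 ∧ ψ.IsPrimitive ∧
      algebraMap (PadicAlgCl 2) ℂ_[2] (ψ (5 : ZMod (2 ^ (N + 2)))) = ζ := by
  classical
  obtain ⟨n, rfl⟩ : ∃ n, N = n + 1 := ⟨N - 1, by omega⟩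
  show ∃ ψ : DirichletCharacter (PadicAlgCl 2) (2 ^ (n + 3)), ψ (-1) = 1 ∧ ψ.IsPrimitive ∧
      algebraMap (PadicAlgCl 2) ℂ_[2] (ψ (5 : ZMod (2 ^ (n + 3)))) = ζ
  haveI : NeZero ((Nat.totient (2 ^ (n + 3)) : ℕ) : PadicAlgCl 2) :=
    ⟨Nat.cast_ne_zero.mpr (Nat.totient_pos.mpr (pow_pos two_pos _)).ne'⟩
  haveI : NeZero (2 ^ (n + 3)) := ⟨pow_ne_zero _ two_ne_zero⟩
  haveI : NeZero (2 ^ (n + 1)) := ⟨pow_ne_zero _ two_ne_zero⟩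
  obtain ⟨ψ₁, hψ₁p, hψ₁e, j, hj⟩ := exists_isPrimitive_even_orderOf_eq_prime_pow (PadicAlgCl 2) (p := 2) n
  set g₂ : PadicAlgCl 2 →+* ℂ_[2] := algebraMap (PadicAlgCl 2) ℂ_[2] with hg₂
  set χ₁ : DirichletCharacter ℂ_[2] (2 ^ (n + 3)) := ψ₁.ringHomComp g₂ with hχ₁
  have hχ₁p : χ₁.IsPrimitive := (isPrimitive_ringHomComp_iff g₂ ψ₁).mpr hψ₁p
  have hχ₁e : χ₁.Even := (even_ringHomComp_iff g₂ ψ₁).mpr hψ₁e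
  have hχ₁o : ∃ j : ℕ, orderOf χ₁ = 2 ^ j := ⟨j, by rw [hχ₁, orderOf_ringHomComp, hj]⟩
  have hce : cyclotomicExponent 2 = 2 := by rw [cyclotomicExponent, if_pos rfl]
  have h5 : ((cyclotomicGenerator 2 : ℕ) : ZMod (2 ^ (n + 3))) = (5 : ZMod (2 ^ (n + 3))) := by
    show ((1 + 2 ^ cyclotomicExponent 2 : ℕ) : ZMod (2 ^ (n + 3))) = 5
    rw [hce]; norm_num
  have hord : orderOf (χ₁ (5 : ZMod (2 ^ (n + 3)))) = 2 ^ (n + 1) := by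
    have h1 := orderOf_apply_cyclotomicGenerator (p := 2) (m := n + 3) (by rw [hce]; omega) χ₁ hχ₁p hχ₁e hχ₁o
    rwa [h5, hce, show n + 3 - 2 = n + 1 by omega] at h1
  have hval : χ₁ (5 : ZMod (2 ^ (n + 3))) = g₂ (ψ₁ (5 : ZMod (2 ^ (n + 3)))) := by
    rw [hχ₁, MulChar.ringHomComp_apply]
  have hη : IsPrimitiveRoot (g₂ (ψ₁ (5 : ZMod (2 ^ (n + 3))))) (2 ^ (n + 1)) := by
    rw [← hval, ← hord]
    exact IsPrimitiveRoot.orderOf _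
  obtain ⟨i, -, hi⟩ := hη.eq_pow_of_pow_eq_one hζ.pow_eq_one
  have hic : i.Coprime (2 ^ (n + 1)) := (hη.pow_iff_coprime (pow_pos two_pos _) i).mp (by rw [hi]; exact hζ)
  have hi2 : i.Coprime 2 := (Nat.coprime_pow_right_iff (by omega) i 2).mp hic
  have hio : i.Coprime (orderOf ψ₁) := by rw [hj]; exact hi2.pow_right j
  obtain ⟨b, hb⟩ := exists_pow_eq_self_of_coprime hio
  obtain ⟨u5, hu5⟩ := isUnit_cyclotomicGenerator_cast (p := 2) (n + 3)
  refine ⟨ψ₁ ^ i, ?_, ?_, ?_⟩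
  · rw [← Units.coe_neg_one, MulChar.pow_apply_coe, Units.coe_neg_one, hψ₁e, one_pow]
  · rw [DirichletCharacter.isPrimitive_def] at hψ₁p ⊢
    refine Nat.dvd_antisymm ?_ ?_
    · have h := DirichletCharacter.conductor_pow_dvd ψ₁ i
      rwa [hψ₁p] at h
    · have h := DirichletCharacter.conductor_pow_dvd (ψ₁ ^ i) b
      rwa [hb, hψ₁p] at h
  · rw [← h5, ← hu5, MulChar.pow_apply_coe, map_pow, hu5, h5, hi]

/-- **`ψ(5)` has exact order `2^N` (read in `ℂ₂`) for an even primitive `ℚ̄₂`-valued `ψ` mod `2^{N+2}`, `N ≥ 1`** — the INTO direction of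
(H-CHAR) (`orderOf_apply_cyclotomicGenerator`; k2-g28 files the same adapter independently as `SideaK2G28.isPrimitiveRoot_apply_five`).
[cite: Washington1997, §7.2] [cite: MazurTateTeitelbaum1986Invent, §I.13] -/
theorem isPrimitiveRoot_apply_five {N : ℕ} (hN : 1 ≤ N) (ψ : DirichletCharacter (PadicAlgCl 2) (2 ^ (N + 2)))
    (hψe : ψ (-1) = 1) (hψp : ψ.IsPrimitive) :
    IsPrimitiveRoot (algebraMap (PadicAlgCl 2) ℂ_[2] (ψ (5 : ZMod (2 ^ (N + 2))))) (2 ^ N) := by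
  classical
  haveI : NeZero (2 ^ (N + 2)) := ⟨pow_ne_zero _ two_ne_zero⟩
  set g₂ : PadicAlgCl 2 →+* ℂ_[2] := algebraMap (PadicAlgCl 2) ℂ_[2] with hg₂
  set χ : DirichletCharacter ℂ_[2] (2 ^ (N + 2)) := ψ.ringHomComp g₂ with hχ
  have hχp : χ.IsPrimitive := (isPrimitive_ringHomComp_iff g₂ ψ).mpr hψp
  have hχe : χ.Even := (even_ringHomComp_iff g₂ ψ).mpr (show ψ.Even from hψe)
  have hχo : ∃ j : ℕ, orderOf χ = 2 ^ j := exists_orderOf_eq_two_pow (N + 1) χ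
  have hce : cyclotomicExponent 2 = 2 := by rw [cyclotomicExponent, if_pos rfl]
  have h5 : ((cyclotomicGenerator 2 : ℕ) : ZMod (2 ^ (N + 2))) = (5 : ZMod (2 ^ (N + 2))) := by
    show ((1 + 2 ^ cyclotomicExponent 2 : ℕ) : ZMod (2 ^ (N + 2))) = 5
    rw [hce]; norm_num
  have hord : orderOf (χ (5 : ZMod (2 ^ (N + 2)))) = 2 ^ N := by
    have h1 := orderOf_apply_cyclotomicGenerator (p := 2) (m := N + 2) (by rw [hce]; omega) χ hχp hχe hχo
    rwa [h5, hce, show N + 2 - 2 = N by omega] at h1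
  have hval : χ (5 : ZMod (2 ^ (N + 2))) = g₂ (ψ (5 : ZMod (2 ^ (N + 2)))) := by
    rw [hχ, MulChar.ringHomComp_apply]
  rw [← hval, ← hord]
  exact IsPrimitiveRoot.orderOf _


end Summit.BirchSwinnertonDyer.BirchSwinnertonDyer.Theorems.ThetaTransport.StationRValVisible

end
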